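import Literature.MathematicalPhysics.KineticTheory.EvenPolynomialPotentials
import Literature.MathematicalPhysics.KineticTheory.InfiniteChainSuperstableEstimates
import HarnessLib

/-!
# Energy bounds for the severed chain dynamics with even polynomial potentials

Topic `Literature/MathematicalPhysics/KineticTheory`; a thin companion of
`InfiniteChainSuperstableEstimates.lean` (which has the local energies `W_{μ,k}`, the growth
functional `Q`, the severed energy `H_Λ` on chain configurations, its conservation along severed
solutions and the box bounds of Buttà–Marchioro §3, (3.6)–(3.8)) for the proof of
Buttà–Marchioro 2016, Thm 2.1 (`InfiniteChainSuperstableDynamics.lean`) along the files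
`SeveredChainComparison` → `ButtaMarchioroFlowConvergence` → `ButtaMarchioroGrowthBound` →
`InfiniteChainSuperstableUniqueness` → `InfiniteChainSuperstableDynamicsProofs`.

What is added here, for potentials `U`, `V` satisfying `IsEvenPolyOfDegree` (so `U, V ≥ 0`, `C^∞`):

* `condB1_of_isEvenPolyOfDegree` — the severed flows exist (`P.CondB1`); downstream statements use
  the term `condB1_of_isEvenPolyOfDegree hU hV` for the flow `severedFlow`;
* the severed energy for a GENERAL finite `Λ` (the nested-box comparison of
  `SeveredChainComparison` compares boxes with different centres, `Λ_{μ,N} ⊆ Λ_{0,N+|μ|}`, and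
  works with the conserved `H_{Λ'}(σ)` of the larger box): `sevEnergy_restrict` (the case `τ = σ`
  of `sevEnergy_restrict_eq`), `mem_sevBonds`, `apply_V_le_sevEnergy` (every bond meeting `Λ`),
  monotonicity `sevEnergy_restrict_mono` in `Λ`, conservation `sevEnergy_severedFlow`
  (`H_Λ(T_t σ) = H_Λ(σ)`, from `sevEnergy_eq_of_isSeveredSolution`), and along the severed flow of
  any finite `Λ`: `|p_i(t)| ≤ (2H_Λ(σ))^{1/2}`, `U(q_i(t)) ≤ H_Λ(σ)`, `V(q_{j+1}(t) - q_j(t)) ≤ H_Λ(σ)`,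
  `|q_i(t) - q_i(0)| ≤ |t| (2H_Λ(σ))^{1/2}` (the box/`W_{μ,n+1}` versions are
  `severedFlow_energy_bounds`, `severedFlow_displacement_le` upstream);
* momentum REVERSAL `R : σ ↦ (q, -p)`: `IsSeveredSolution.reverse`, `IsSolution.reverse`,
  `severedFlow_reverse` (`T_t (R σ) = R (T_{-t} σ)`), `fst_severedFlow_neg` / `snd_severedFlow_neg`,
  invariance of `H_Λ`, `W_{μ,k}`, the growth set, `Q`, `𝒳₀` under `R` ("without loss of generality
  we consider the case `t > 0`", BM §3);
* on `𝒳₀`: `bmGrowth_le_iff` and `H_{Λ_{μ,n}}(σ) ≤ Q(σ)(2n+3)` for `n + 1 > log(e+|μ|)`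
  (`sevEnergy_box_le_bmGrowth_mul`, from `sevEnergy_le_bmLocalEnergy_succ` and
  `bmLocalEnergy_le_of_lt`).

Everything here is proved; no new definitions, no named facts.

## References

* P. Buttà, C. Marchioro, J. Stat. Phys. 164 (2016) 680–692, doi:10.1007/s10955-016-1540-x,
  §3 (partial dynamics (3.1)–(3.2), energy conservation (3.6), bounds (3.7)–(3.8)). [ButtaMarchioro2016]
* O. E. Lanford, J. L. Lebowitz, E. H. Lieb, J. Stat. Phys. 16 (1977) 453–461, §2 (9a)–(9c)
  (the severed dynamics). [LanfordLebowitzLieb1977]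
-/

noncomputable section

open Set Filter Metric
open scoped Topology

namespace Literature.MathematicalPhysics.KineticTheory.HeatConduction

namespace OscillatorChain

variable {P : OscillatorChain} {s₁ s₂ : ℕ}

/-! ### Existence of the severed flows for even polynomial potentials -/

/-- For even polynomial `U`, `V` the severed equations have global solutions from every initial
configuration (LLL's condition B1), by `condB1_of_bddBelow`. [cite: ButtaMarchioro2016, §3 after eq. (3.2)] -/
theorem condB1_of_isEvenPolyOfDegree (hU : IsEvenPolyOfDegree P.U s₁)
    (hV : IsEvenPolyOfDegree P.V s₂) : P.CondB1 :=
  condB1_of_bddBelow P hU.contDiff hV.contDiff hU.bddBelow_range hV.bddBelow_range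

/-! ### The severed energy of a configuration (general finite `Λ`) -/

/-- The severed energy of the configuration `σ` itself: the case `τ = σ` of
`sevEnergy_restrict_eq`. [folklore] -/
theorem sevEnergy_restrict (P : OscillatorChain) (Λ : Finset ℤ) (σ : ChainConfig) :
    sevEnergy P Λ σ 0 0 (fun i : ↥Λ => σ i) =
      (∑ i ∈ Λ, ((σ i).2 ^ 2 / 2 + P.U (σ i).1)) +
        ∑ j ∈ sevBonds Λ, P.V ((σ (j + 1)).1 - (σ j).1) :=
  sevEnergy_restrict_eq fun _ _ => rfl

/-- Membership in the bond set: `j ∈ sevBonds Λ ↔ j ∈ Λ ∨ j + 1 ∈ Λ`. [folklore] -/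
theorem mem_sevBonds {Λ : Finset ℤ} {j : ℤ} : j ∈ sevBonds Λ ↔ j ∈ Λ ∨ j + 1 ∈ Λ := by
  simp only [sevBonds, Finset.mem_union, Finset.mem_image]
  constructor
  · rintro (h | ⟨i, hi, rfl⟩)
    · exact Or.inl h
    · right; simpa using hi
  · rintro (h | h)
    · exact Or.inl h
    · exact Or.inr ⟨j + 1, h, by ring⟩

section Domination

variable (hU : IsEvenPolyOfDegree P.U s₁) (hV : IsEvenPolyOfDegree P.V s₂)
include hU hV

/-- `H_Λ(σ) ≥ 0` for non-negative potentials. [folklore] -/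
theorem sevEnergy_restrict_nonneg (Λ : Finset ℤ) (σ : ChainConfig) :
    0 ≤ sevEnergy P Λ σ 0 0 (fun i : ↥Λ => σ i) := by
  rw [sevEnergy_restrict]
  exact add_nonneg (Finset.sum_nonneg fun i _ => add_nonneg (by positivity) (hU.nonneg _))
    (Finset.sum_nonneg fun j _ => hV.nonneg _)

/-- Pinning terms are dominated by the severed energy: `U(q_i) ≤ H_Λ(σ)` for `i ∈ Λ`
(from `site_le_sevSum`). [folklore] -/
theorem apply_U_le_sevEnergy (Λ : Finset ℤ) (σ : ChainConfig) {i : ℤ} (hi : i ∈ Λ) :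
    P.U (σ i).1 ≤ sevEnergy P Λ σ 0 0 (fun i : ↥Λ => σ i) := by
  rw [sevEnergy_restrict]
  exact (site_le_sevSum hU.nonneg hV.nonneg σ hi).2

/-- Bond terms are dominated by the severed energy: `V(q_{j+1} - q_j) ≤ H_Λ(σ)` for every bond
meeting `Λ`. [folklore] -/
theorem apply_V_le_sevEnergy (Λ : Finset ℤ) (σ : ChainConfig) {j : ℤ} (hj : j ∈ Λ ∨ j + 1 ∈ Λ) :
    P.V ((σ (j + 1)).1 - (σ j).1) ≤ sevEnergy P Λ σ 0 0 (fun i : ↥Λ => σ i) := by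
  rw [sevEnergy_restrict]
  have h1 : P.V ((σ (j + 1)).1 - (σ j).1) ≤ ∑ j ∈ sevBonds Λ, P.V ((σ (j + 1)).1 - (σ j).1) :=
    Finset.single_le_sum (f := fun j => P.V ((σ (j + 1)).1 - (σ j).1))
      (fun j _ => hV.nonneg _) (mem_sevBonds.2 hj)
  have h2 : 0 ≤ ∑ i ∈ Λ, ((σ i).2 ^ 2 / 2 + P.U (σ i).1) :=
    Finset.sum_nonneg fun i _ => add_nonneg (by positivity) (hU.nonneg _)
  linarith

/-- The severed energy is monotone in the box: `H_Λ(σ) ≤ H_{Λ'}(σ)` for `Λ ⊆ Λ'`. [folklore] -/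
theorem sevEnergy_restrict_mono {Λ Λ' : Finset ℤ} (h : Λ ⊆ Λ') (σ : ChainConfig) :
    sevEnergy P Λ σ 0 0 (fun i : ↥Λ => σ i) ≤ sevEnergy P Λ' σ 0 0 (fun i : ↥Λ' => σ i) := by
  rw [sevEnergy_restrict, sevEnergy_restrict]
  have hb : sevBonds Λ ⊆ sevBonds Λ' := by
    intro j hj
    rcases mem_sevBonds.1 hj with hj | hj
    · exact mem_sevBonds.2 (Or.inl (h hj))
    · exact mem_sevBonds.2 (Or.inr (h hj))
  exact add_le_add
    (Finset.sum_le_sum_of_subset_of_nonneg h fun i _ _ => add_nonneg (by positivity) (hU.nonneg _))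
    (Finset.sum_le_sum_of_subset_of_nonneg hb fun j _ _ => hV.nonneg _)

end Domination

/-! ### Conservation of the severed energy along the severed flow -/

/-- **Energy conservation for the severed flow**: `H_Λ(T_t σ) = H_Λ(σ)` (from
`sevEnergy_eq_of_isSeveredSolution`; BM §3, (3.6): "because of the energy conservation law").
[cite: ButtaMarchioro2016, §3 eq. (3.6)] -/
theorem sevEnergy_severedFlow (hU : IsEvenPolyOfDegree P.U s₁) (hV : IsEvenPolyOfDegree P.V s₂)
    (Λ : Finset ℤ) (t : ℝ) (σ : ChainConfig) :
    sevEnergy P Λ (severedFlow (condB1_of_isEvenPolyOfDegree hU hV) Λ t σ) 0 0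
        (fun i : ↥Λ => severedFlow (condB1_of_isEvenPolyOfDegree hU hV) Λ t σ i) =
      sevEnergy P Λ σ 0 0 (fun i : ↥Λ => σ i) := by
  have hγ := isSeveredSolution_severedFlow (condB1_of_isEvenPolyOfDegree hU hV) Λ σ
  have hoff : ∀ j ∉ Λ, severedFlow (condB1_of_isEvenPolyOfDegree hU hV) Λ t σ j = σ j :=
    fun j hj => severedFlow_apply_of_not_mem _ Λ t σ hj
  have h := sevEnergy_eq_of_isSeveredSolution hU.contDiff hV.contDiff hγ t
  simp only [severedFlow_zero] at h
  rw [sevEnergy_restrict_eq hoff] at h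
  rw [sevEnergy_restrict]
  exact h

/-! ### Moment bounds along the severed flow (general finite `Λ`) -/

section Moments

variable (hU : IsEvenPolyOfDegree P.U s₁) (hV : IsEvenPolyOfDegree P.V s₂)
include hU hV

/-- `|p_i(t)| ≤ (2 H_Λ(σ))^{1/2}` along the severed flow, for `i ∈ Λ` (BM §3: the velocity bound
entering `d^μ_n(t)`; box version: `severedFlow_energy_bounds`). [cite: ButtaMarchioro2016, §3 (bound on d^μ_n(t))] -/
theorem abs_snd_severedFlow_le (Λ : Finset ℤ) (σ : ChainConfig) {i : ℤ} (hi : i ∈ Λ) (t : ℝ) :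
    |(severedFlow (condB1_of_isEvenPolyOfDegree hU hV) Λ t σ i).2| ≤
      Real.sqrt (2 * sevEnergy P Λ σ 0 0 (fun i : ↥Λ => σ i)) := by
  have h := (site_le_sevSum hU.nonneg hV.nonneg
    (severedFlow (condB1_of_isEvenPolyOfDegree hU hV) Λ t σ) hi).1
  rw [← sevEnergy_restrict, sevEnergy_severedFlow hU hV] at h
  exact Real.abs_le_sqrt (by linarith)

/-- `U(q_i(t)) ≤ H_Λ(σ)` along the severed flow, for `i ∈ Λ`. [folklore] -/
theorem apply_U_severedFlow_le (Λ : Finset ℤ) (σ : ChainConfig) {i : ℤ} (hi : i ∈ Λ) (t : ℝ) :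
    P.U (severedFlow (condB1_of_isEvenPolyOfDegree hU hV) Λ t σ i).1 ≤
      sevEnergy P Λ σ 0 0 (fun i : ↥Λ => σ i) := by
  have h := apply_U_le_sevEnergy hU hV Λ (severedFlow (condB1_of_isEvenPolyOfDegree hU hV) Λ t σ) hi
  rwa [sevEnergy_severedFlow hU hV] at h

/-- `V(q_{j+1}(t) - q_j(t)) ≤ H_Λ(σ)` along the severed flow, for every bond meeting `Λ`.
[folklore] -/
theorem apply_V_severedFlow_le (Λ : Finset ℤ) (σ : ChainConfig) {j : ℤ} (hj : j ∈ Λ ∨ j + 1 ∈ Λ)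
    (t : ℝ) :
    P.V ((severedFlow (condB1_of_isEvenPolyOfDegree hU hV) Λ t σ (j + 1)).1 -
        (severedFlow (condB1_of_isEvenPolyOfDegree hU hV) Λ t σ j).1) ≤
      sevEnergy P Λ σ 0 0 (fun i : ↥Λ => σ i) := by
  have h := apply_V_le_sevEnergy hU hV Λ (severedFlow (condB1_of_isEvenPolyOfDegree hU hV) Λ t σ) hj
  rwa [sevEnergy_severedFlow hU hV] at h

/-- **Displacement bound** `|q_i(t) - q_i(0)| ≤ |t| (2 H_Λ(σ))^{1/2}` along the severed flow (mean
value inequality with the momentum bound; BM's `d^μ_n(t) ≤ C t φ^{1/2}`). For `i ∉ Λ` the left side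
vanishes. [cite: ButtaMarchioro2016, §3 (bound on d^μ_n(t))] -/
theorem abs_fst_severedFlow_sub_le (Λ : Finset ℤ) (σ : ChainConfig) (i : ℤ) (t : ℝ) :
    |(severedFlow (condB1_of_isEvenPolyOfDegree hU hV) Λ t σ i).1 - (σ i).1| ≤
      |t| * Real.sqrt (2 * sevEnergy P Λ σ 0 0 (fun i : ↥Λ => σ i)) := by
  by_cases hi : i ∈ Λ
  · set M := Real.sqrt (2 * sevEnergy P Λ σ 0 0 (fun i : ↥Λ => σ i)) with hM
    have hsol := isSeveredSolution_severedFlow (condB1_of_isEvenPolyOfDegree hU hV) Λ σ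
    have hderiv : ∀ s, HasDerivAt (fun s => (severedFlow (condB1_of_isEvenPolyOfDegree hU hV) Λ s σ i).1)
        (severedFlow (condB1_of_isEvenPolyOfDegree hU hV) Λ s σ i).2 s := fun s => (hsol.1 i hi s).1
    have hbound : ∀ s, ‖(severedFlow (condB1_of_isEvenPolyOfDegree hU hV) Λ s σ i).2‖ ≤ M := fun s => by
      rw [Real.norm_eq_abs]; exact abs_snd_severedFlow_le hU hV Λ σ hi s
    have key := Convex.norm_image_sub_le_of_norm_hasDerivWithin_le (s := univ)
      (f := fun s => (severedFlow (condB1_of_isEvenPolyOfDegree hU hV) Λ s σ i).1) (fun s _ => (hderiv s).hasDerivWithinAt)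
      (fun s _ => hbound s) convex_univ (mem_univ 0) (mem_univ t)
    simp only [severedFlow_zero, sub_zero, Real.norm_eq_abs] at key
    rw [mul_comm] at key
    exact key
  · rw [severedFlow_apply_of_not_mem (condB1_of_isEvenPolyOfDegree hU hV) Λ t σ hi, sub_self, abs_zero]
    positivity

end Moments

/-! ### Momentum reversal -/

/-- Time reversal of a severed solution: `t ↦ R γ(-t)`, `R(q, p) = (q, -p)`, is again a severed
solution (the force depends on the positions only). [folklore] -/
theorem IsSeveredSolution.reverse {Λ : Finset ℤ} {γ : ℝ → ChainConfig}
    (hγ : P.IsSeveredSolution Λ γ) :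
    P.IsSeveredSolution Λ fun t => fun j => ((γ (-t) j).1, -(γ (-t) j).2) := by
  refine ⟨fun i hi t => ?_, fun i hi t => ?_⟩
  · obtain ⟨h1, h2⟩ := hγ.1 i hi (-t)
    have h1' := h1.comp t (hasDerivAt_neg t)
    have h2' := (h2.comp t (hasDerivAt_neg t)).neg
    have hforce : P.force (fun j => ((γ (-t) j).1, -(γ (-t) j).2)) i = P.force (γ (-t)) i := by
      simp only [force_eq]
    refine ⟨?_, ?_⟩
    · simpa [Function.comp_def] using h1'
    · rw [hforce]
      simpa [Function.comp_def, Pi.neg_def] using h2'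
  · simp only [neg_zero]
    rw [hγ.2 i hi (-t)]

/-- Time reversal of a solution of the infinite system: `t ↦ R γ(-t)` solves (1a)–(1b) as well.
[folklore] -/
theorem IsSolution.reverse {γ : ℝ → ChainConfig} (hγ : P.IsSolution γ) :
    P.IsSolution fun t => fun j => ((γ (-t) j).1, -(γ (-t) j).2) := by
  intro i t
  obtain ⟨h1, h2⟩ := hγ i (-t)
  have h1' := h1.comp t (hasDerivAt_neg t)
  have h2' := (h2.comp t (hasDerivAt_neg t)).neg
  have hforce : P.force (fun j => ((γ (-t) j).1, -(γ (-t) j).2)) i = P.force (γ (-t)) i := by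
    simp only [force_eq]
  refine ⟨?_, ?_⟩
  · simpa [Function.comp_def] using h1'
  · rw [hforce]
    simpa [Function.comp_def, Pi.neg_def] using h2'

/-- Reversal is an involution on configurations. [folklore] -/
theorem reverse_reverse (σ : ChainConfig) :
    ((fun j => ((σ j).1, -(-(σ j).2))) : ChainConfig) = σ := by
  funext j; simp

/-- **Reversal symmetry of the severed flow**: `T_t (R σ) = R (T_{-t} σ)` (uniqueness of severed
solutions, `U, V ∈ C²`). [folklore] -/
theorem severedFlow_reverse (hU : IsEvenPolyOfDegree P.U s₁) (hV : IsEvenPolyOfDegree P.V s₂)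
    (Λ : Finset ℤ) (t : ℝ) (σ : ChainConfig) :
    severedFlow (condB1_of_isEvenPolyOfDegree hU hV) Λ t (fun j => ((σ j).1, -(σ j).2)) =
      fun j => ((severedFlow (condB1_of_isEvenPolyOfDegree hU hV) Λ (-t) σ j).1, -(severedFlow (condB1_of_isEvenPolyOfDegree hU hV) Λ (-t) σ j).2) := by
  have h := ((isSeveredSolution_severedFlow (condB1_of_isEvenPolyOfDegree hU hV) Λ σ).reverse).eq_severedFlow (hB1 := condB1_of_isEvenPolyOfDegree hU hV)
    hU.contDiff hV.contDiff t
  simp only [neg_zero, severedFlow_zero] at h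
  exact h.symm

/-- Positions at negative times are positions of the reversed datum at positive times:
`q_j(T_{-t} σ) = q_j(T_t (Rσ))`. [folklore] -/
theorem fst_severedFlow_neg (hU : IsEvenPolyOfDegree P.U s₁) (hV : IsEvenPolyOfDegree P.V s₂)
    (Λ : Finset ℤ) (t : ℝ) (σ : ChainConfig) (j : ℤ) :
    (severedFlow (condB1_of_isEvenPolyOfDegree hU hV) Λ (-t) σ j).1 = (severedFlow (condB1_of_isEvenPolyOfDegree hU hV) Λ t (fun j => ((σ j).1, -(σ j).2)) j).1 := by
  rw [severedFlow_reverse hU hV]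

/-- Momenta at negative times: `p_j(T_{-t} σ) = -p_j(T_t (Rσ))`. [folklore] -/
theorem snd_severedFlow_neg (hU : IsEvenPolyOfDegree P.U s₁) (hV : IsEvenPolyOfDegree P.V s₂)
    (Λ : Finset ℤ) (t : ℝ) (σ : ChainConfig) (j : ℤ) :
    (severedFlow (condB1_of_isEvenPolyOfDegree hU hV) Λ (-t) σ j).2 = -(severedFlow (condB1_of_isEvenPolyOfDegree hU hV) Λ t (fun j => ((σ j).1, -(σ j).2)) j).2 := by
  rw [severedFlow_reverse hU hV]
  simp

/-- The severed energy is reversal invariant. [folklore] -/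
theorem sevEnergy_restrict_reverse (P : OscillatorChain) (Λ : Finset ℤ) (σ : ChainConfig) :
    sevEnergy P Λ (fun j => ((σ j).1, -(σ j).2)) 0 0
        (fun i : ↥Λ => ((σ i).1, -(σ i).2)) =
      sevEnergy P Λ σ 0 0 (fun i : ↥Λ => σ i) := by
  rw [sevEnergy_restrict, sevEnergy_restrict]
  simp

/-- BM's local energy `W_{μ,k}` is reversal invariant. [folklore] -/
theorem bmLocalEnergy_reverse (P : OscillatorChain) (μ : ℤ) (k : ℕ) (σ : ChainConfig) :
    P.bmLocalEnergy μ k (fun j => ((σ j).1, -(σ j).2)) = P.bmLocalEnergy μ k σ := by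
  simp [bmLocalEnergy]

/-- The growth set is reversal invariant. [folklore] -/
theorem bmGrowthSet_reverse (P : OscillatorChain) (σ : ChainConfig) :
    P.bmGrowthSet (fun j => ((σ j).1, -(σ j).2)) = P.bmGrowthSet σ := by
  simp only [bmGrowthSet, bmLocalEnergy_reverse]

/-- `Q` is reversal invariant. [folklore] -/
theorem bmGrowth_reverse (P : OscillatorChain) (σ : ChainConfig) :
    P.bmGrowth (fun j => ((σ j).1, -(σ j).2)) = P.bmGrowth σ := by
  simp only [bmGrowth, bmGrowthSet_reverse]

/-- `𝒳₀` is reversal invariant. [folklore] -/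
theorem reverse_mem_bmGood_iff (P : OscillatorChain) (σ : ChainConfig) :
    (fun j => ((σ j).1, -(σ j).2)) ∈ P.bmGood ↔ σ ∈ P.bmGood := by
  simp only [bmGood, mem_setOf_eq, bmGrowthSet_reverse]

/-! ### `H_Λ` against `Q` on `𝒳₀` -/

/-- `Q(σ) ≤ N` on `𝒳₀` iff every normalised local energy is `≤ N`. [folklore] -/
theorem bmGrowth_le_iff {σ : ChainConfig} (hσ : σ ∈ P.bmGood) (N : ℝ) :
    P.bmGrowth σ ≤ N ↔ ∀ (μ : ℤ) (k : ℕ), Real.log (Real.exp 1 + |(μ : ℝ)|) < k →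
      P.bmLocalEnergy μ k σ / (2 * (k : ℝ) + 1) ≤ N := by
  rw [bmGrowth, csSup_le_iff hσ (bmGrowthSet_nonempty σ)]
  constructor
  · intro h μ k hk
    exact h _ ⟨μ, k, hk, rfl⟩
  · rintro h _ ⟨μ, k, hk, rfl⟩
    exact h μ k hk

/-- **The severed energy of `Λ_{μ,n}` on `𝒳₀`**: `H_{Λ_{μ,n}}(σ) ≤ Q(σ) (2n+3)` whenever
`n + 1 > log(e + |μ|)` (`sevEnergy_le_bmLocalEnergy_succ` and `bmLocalEnergy_le_of_lt`; BM §3,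
(3.7)–(3.8) with `φ_{μ,n}`). [cite: ButtaMarchioro2016, §3 eqs. (3.7)–(3.8)] -/
theorem sevEnergy_box_le_bmGrowth_mul (hU : IsEvenPolyOfDegree P.U s₁) (hV : IsEvenPolyOfDegree P.V s₂)
    {σ : ChainConfig} (hσ : σ ∈ P.bmGood) (μ : ℤ) {n : ℕ}
    (hn : Real.log (Real.exp 1 + |(μ : ℝ)|) < (n + 1 : ℕ)) :
    sevEnergy P (Finset.Icc (μ - n) (μ + n)) σ 0 0 (fun i : ↥(Finset.Icc (μ - n) (μ + n)) => σ i) ≤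
      P.bmGrowth σ * (2 * (n : ℝ) + 3) := by
  have h1 : sevEnergy P (Finset.Icc (μ - n) (μ + n)) σ 0 0
      (fun i : ↥(Finset.Icc (μ - n) (μ + n)) => σ i) ≤ P.bmLocalEnergy μ (n + 1) σ := by
    rw [sevEnergy_restrict]
    exact sevEnergy_le_bmLocalEnergy_succ hU.nonneg hV.nonneg μ n σ
  have h2 := bmLocalEnergy_le_of_lt hσ hn
  have h3 : P.bmGrowth σ * (2 * ((n + 1 : ℕ) : ℝ) + 1) = P.bmGrowth σ * (2 * (n : ℝ) + 3) := by
    push_cast; ring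
  linarith

end OscillatorChain

end Literature.MathematicalPhysics.KineticTheory.HeatConduction
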